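import Summits.Ventures.WeilGRH.DualTrigKernelFamily
import Summits.Ventures.WeilGRH.KeyPolytope
import HarnessLib

/-!
# Format D-K soundness at the level of KEYS: one certificate ⇒ `WeilPositivityOnKey (c.par, log c.q, v, c.N)`

Cell `rh-explicit`, WEIL TRACK — GRH ARM, route B (weil-grh-3).  A format-D-K certificate `c` lists claimed
values `e^{2πi u/v}` at the prime powers `n ≤ c.N` and certifies, by `decide +kernel`,
`0 ≤ Re ψ(1/4 + a/2 + iτ/2) + (log c.q − log π) + Σ_n (window terms) + T(τ)` on `ℝ`
(`DKCert.Pθ_nonneg_of_check`).  The character-level soundness (`DualTrigKernelFamily.lean`) reads this as the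
multiplier inequality of every Dirichlet character with those values.  This file reads the SAME certificate
at the level of the KEY vocabulary of `KeyPolytope.lean` (weil-grh-5): for any prime datum `v : ℕ → ℂ`
agreeing with the claimed values on the listed prime powers, and provided every prime power `n ≤ c.N` is
listed (`(n, c.q) = 1`), the certificate gives

* `DKCert.sound_key` — `0 ≤ M_{c.par, log c.q, v, c.N}(τ) + T(τ)` for every real `τ`, and
* `DKCert.weilPositivityOnKey_of_check` — `WeilPositivityOnKey c.par (log c.q) v c.N`
  (`weilPositivityOnKey_of_trigDual`).

The point: a key need not be realised by any character.  The ALL-TRIVIAL key `v = 1` (weil-grh-2's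
pseudo-key) is the universal minorant of its parity class — `KeyMinorant.lean` / `KeyWindowDilation.lean`
(weil-grh-5): `WeilPositivityOnKey a L₀ 1 N ⇒ WeilPositivityOnChar χ t` for EVERY `χ` of parity `a` with
`L₀ ≤ log q`, `t ≤ log(N+1)/2` — so ONE kernel certificate at the all-trivial key is a uniform conductor
floor for all characters (instances: `DualTrigTrivialKey*.lean`).  Everything here is PROVED; no named facts.

## References

* A. Weil (1952), (11) pp. 261–262 [Weil1952FormulesExplicites]; H. Yoshida (1992), §2 (2.1) [Yoshida1992].
-/

noncomputable section

open Finset Real Complex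

namespace Summit.Ventures.WeilGRH

open Literature.Analysis.ValidatedNumerics.NumericsMP
open Literature.NumberTheory.LFunctions
open DualTrigTaylor DigammaVertical
open scoped ArithmeticFunction.vonMangoldt

namespace DKCert

variable {c : DKCert} {v : ℕ → ℂ}

/-- One window term evaluates to minus the corresponding summand of the KEY ripple, for any prime datum
`v` taking the claimed value at `n`. [folklore] -/
theorem valR_val_key (hp0 : 2 ≤ c.p0) (hD : 1 ≤ c.D) {val : DKVal} (hp : Nat.Prime val.p) (he : 1 ≤ val.e)
    (hpe : val.p ^ val.e = val.n) (hv : v val.n = valZ val) (τ : ℝ) :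
    (c.valR val).val (c.omegaR * τ) =
      -((Λ val.n : ℝ) / Real.sqrt val.n * (2 * ((v val.n).re * Real.cos (τ * Real.log val.n) +
        (v val.n).im * Real.sin (τ * Real.log val.n)))) := by
  have hp0r : (1 : ℝ) < c.p0 := by exact_mod_cast hp0
  have hlogp0 : Real.log c.p0 ≠ 0 := (Real.log_pos hp0r).ne'
  have hDr : (c.D : ℝ) ≠ 0 := by exact_mod_cast (show c.D ≠ 0 by omega)
  have hΛ : (Λ val.n : ℝ) = Real.log val.p := by
    rw [← hpe, ArithmeticFunction.vonMangoldt_apply_pow (by omega), ArithmeticFunction.vonMangoldt_apply_prime hp]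
  have hfreq : (c.valR val).κ * (c.omegaR * τ) = τ * Real.log val.n := by
    simp only [valR, omegaR]; field_simp
  rw [hv, RTerm.val, hfreq, hΛ]
  simp only [valR, div_eq_mul_inv]
  ring

/-- **The window terms evaluate to minus the KEY ripple** `ρ_{v, c.N}` for any prime datum `v` with the
claimed values at the listed prime powers, when every prime power `n ≤ c.N` is coprime to `c.q` (hence
listed, by `valsOK`). [folklore] -/
theorem sumVal_valsR_eq_key (hp0 : 2 ≤ c.p0) (hD : 1 ≤ c.D) (hvals : c.valsOK = true)
    (hnodup : (c.vals.map (·.n)).Nodup) (hv : ∀ val ∈ c.vals, v val.n = valZ val)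
    (hall : ∀ n : ℕ, n ≤ c.N → IsPrimePow n → Nat.Coprime n c.q) (τ : ℝ) :
    sumVal (c.vals.map c.valR) (c.omegaR * τ) = -weilPrimeRippleKey v c.N τ := by
  set F : ℕ → ℝ := fun n ↦ (Λ n : ℝ) / Real.sqrt n * (2 * ((v n).re * Real.cos (τ * Real.log n) +
    (v n).im * Real.sin (τ * Real.log n))) with hFdef
  have h1 : sumVal (c.vals.map c.valR) (c.omegaR * τ) = -((c.vals.map (·.n)).map F).sum := by
    have : ∀ vs : List DKVal, (∀ w ∈ vs, w ∈ c.vals) →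
        sumVal (vs.map c.valR) (c.omegaR * τ) = -((vs.map (·.n)).map F).sum := by
      intro vs
      induction vs with
      | nil => simp
      | cons w vs ih =>
          intro hmem
          obtain ⟨hp, he, hpe, -⟩ := valsOK_val hvals (hmem w (by simp))
          rw [List.map_cons, sumVal_cons, ih (fun w' hw' ↦ hmem w' (by simp [hw'])),
            valR_val_key hp0 hD hp he hpe (hv w (hmem w (by simp))) τ]
          simp [hFdef]; ring
    exact this c.vals fun w hw ↦ hw
  rw [h1]
  unfold weilPrimeRippleKey
  rw [show (∑ n ∈ range (c.N + 1), (Λ n : ℝ) / Real.sqrt n * (2 * ((v n).re *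
      Real.cos (τ * Real.log n) + (v n).im * Real.sin (τ * Real.log n)))) =
      ∑ n ∈ range (c.N + 1), F n from rfl]
  rw [← List.sum_toFinset _ hnodup]
  congr 1
  apply Finset.sum_subset
  · intro n hn
    rw [List.mem_toFinset, List.mem_map] at hn
    obtain ⟨w, hw, rfl⟩ := hn
    exact Finset.mem_range.2 (by have := (valsOK_val hvals hw).2.2.2.1; omega)
  · intro n hn hnot
    by_cases hpp : IsPrimePow n
    · -- a prime power `n ≤ N` is coprime to `c.q` (hypothesis), hence listed by `valsOK`: contradiction
      exfalso
      have hco : Nat.Coprime n c.q := hall n (by have := Finset.mem_range.1 hn; omega) hpp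
      have hvals' := hvals
      unfold valsOK at hvals'
      simp only [Bool.and_eq_true] at hvals'
      obtain ⟨⟨⟨_, _⟩, hcov⟩, _⟩ := hvals'
      rw [List.all_eq_true] at hcov
      have hc' := hcov n (List.mem_range.2 (Finset.mem_range.1 hn))
      rw [Bool.or_eq_true, Bool.or_eq_true] at hc'
      rcases hc' with (h1 | h2) | h3
      · rw [List.any_eq_true] at h1
        obtain ⟨w, hw, hwn⟩ := h1
        rw [beq_iff_eq] at hwn
        exact hnot (List.mem_toFinset.2 (List.mem_map.2 ⟨w, hw, hwn⟩))
      · have hc2 : coprimeB n c.q = true := (coprimeB_iff n c.q).2 hco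
        rw [hc2] at h2; exact absurd h2 (by decide)
      · have hc3 : isPrimePowB n = true := isPrimePowB_of_isPrimePow hpp
        rw [hc3] at h3; exact absurd h3 (by decide)
    · rw [ArithmeticFunction.vonMangoldt_eq_zero_iff.2 hpp]; simp

/-- **KEY-LEVEL SOUNDNESS.**  If `c.check = true`, every prime power `n ≤ c.N` is coprime to `c.q`, and the
prime datum `v` takes the claimed values at the listed prime powers, then
`0 ≤ M_{c.par, log c.q, v, c.N}(τ) + T(τ)` for every real `τ` — whether or not the key is a character.
[folklore] -/
theorem sound_key (hc : c.check = true) (hv : ∀ val ∈ c.vals, v val.n = valZ val)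
    (hall : ∀ n : ℕ, n ≤ c.N → IsPrimePow n → Nat.Coprime n c.q) (τ : ℝ) :
    0 ≤ weilFinitePrimeWeightKey c.par (Real.log c.q) v c.N τ + trigSum (c.atoms.map c.atomT) τ := by
  have hmain := Pθ_nonneg_of_check hc (c.omegaR * τ)
  unfold check frameOK at hc
  simp only [Bool.and_eq_true] at hc
  obtain ⟨⟨⟨⟨⟨⟨hconsts, hvals⟩, hnodup⟩, _⟩, _⟩, _⟩, _⟩ := hc
  obtain ⟨_, hp0, hD, _, _, _, _, _, _, _⟩ := constsOK_sound hconsts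
  obtain ⟨_, hρω⟩ := rhoR_pos_and_mul hp0 hD
  unfold Pθ at hmain
  have hval := sumVal_valsR_eq_key (v := v) hp0 hD hvals (by
    unfold valsNodup at hnodup; simpa using hnodup) hv hall τ
  unfold termsR at hmain
  rw [sumVal_append, sumVal_atoms, hval] at hmain
  unfold weilFinitePrimeWeightKey
  have harg : (c.sigR : ℂ) + ((c.rhoR * (c.omegaR * τ) : ℝ) : ℂ) * I =
      1 / 4 + (c.par : ℂ) / 2 + (τ : ℂ) / 2 * I := by
    rw [← mul_assoc, hρω]
    unfold sigR
    push_cast; ring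
  rw [harg] at hmain
  unfold constR at hmain
  linarith

/-- **One certificate ⇒ window positivity of the KEY `(c.par, log c.q, v, c.N)`.** [folklore] -/
theorem weilPositivityOnKey_of_check (hc : c.check = true) (hv : ∀ val ∈ c.vals, v val.n = valZ val)
    (hall : ∀ n : ℕ, n ≤ c.N → IsPrimePow n → Nat.Coprime n c.q) :
    WeilPositivityOnKey c.par (Real.log c.q) v c.N := by
  refine weilPositivityOnKey_of_trigDual c.par (Real.log c.q) v c.N (c.atoms.map c.atomT) ?_
    (sound_key hc hv hall)
  have hc' := hc
  unfold check frameOK at hc'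
  simp only [Bool.and_eq_true] at hc'
  obtain ⟨⟨⟨⟨⟨⟨hconsts, _⟩, _⟩, _⟩, hatoms⟩, _⟩, _⟩ := hc'
  obtain ⟨_, hp0, hD, -⟩ := constsOK_sound hconsts
  intro A hA
  rw [List.mem_map] at hA
  obtain ⟨atm, hatm, rfl⟩ := hA
  unfold atomsOK at hatoms
  rw [List.all_eq_true] at hatoms
  have h := hatoms atm hatm
  rw [decide_eq_true_eq] at h
  simp only [atomT, omegaR]
  have hp0r : (1 : ℝ) < c.p0 := by exact_mod_cast hp0
  have hDr : (0 : ℝ) < c.D := by exact_mod_cast hD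
  have hN1 : (0 : ℝ) < (c.N : ℝ) + 1 := by positivity
  have hreal : ((c.N : ℝ) + 1) ^ c.D ≤ (c.p0 : ℝ) ^ atm.k := by exact_mod_cast h
  have hlogle := Real.log_le_log (by positivity) hreal
  rw [Real.log_pow, Real.log_pow] at hlogle
  rw [← mul_div_assoc, le_div_iff₀ hDr]
  linarith

/-- **The ALL-TRIVIAL key from a certificate whose listed values are all `1`** (`u = 0`):
`WeilPositivityOnKey c.par (log c.q) (fun _ ↦ 1) c.N`.  Combined with
`weilPositivityOnChar_of_weilPositivityOnKey_allTrivial` (`KeyMinorant.lean`) this is Weil positivity for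
EVERY character of parity `c.par` and modulus `q ≥ c.q` on every window `t < log(c.N+1)/2`. [folklore] -/
theorem weilPositivityOnKey_allTrivial_of_check (hc : c.check = true)
    (hv : ∀ val ∈ c.vals, valZ val = 1) (hall : ∀ n : ℕ, n ≤ c.N → IsPrimePow n → Nat.Coprime n c.q) :
    WeilPositivityOnKey c.par (Real.log c.q) (fun _ ↦ (1 : ℂ)) c.N :=
  weilPositivityOnKey_of_check hc (fun val hval ↦ (hv val hval).symm) hall

end DKCert

end Summit.Ventures.WeilGRH

end
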